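import Summits.BirchSwinnertonDyer.BirchSwinnertonDyer.Theorems.SprungSharpFlatMainConjecture
import Summits.BirchSwinnertonDyer.BirchSwinnertonDyer.Theorems.SignedLowerHalvesSprungLowerHalfAtThreeChromaticReduction
import Summits.BirchSwinnertonDyer.Rank1Residual.Supersingular.SharpFlatConverseReal
import Literature.NumberTheory.EllipticCurves.Sprung2012.SharpFlatSelmerDualExistsProofs
import Literature.NumberTheory.EllipticCurves.Sprung2012.SharpFlatKatoDivisibility
import Literature.NumberTheory.EllipticCurves.Sprung2012.ColemanMapTheorems
import Literature.NumberTheory.EllipticCurves.Sprung2017.SharpFlatNonvanishingProofs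
import Literature.NumberTheory.EllipticCurves.Sprung2017.SharpFlatPAdicLFunctionProofs
import Literature.NumberTheory.EllipticCurves.Sprung2024.ChromaticCharValueRankZeroAllN
import Literature.NumberTheory.EllipticCurves.CyclotomicZpExtensionLocalGeneratorProofs
import Literature.NumberTheory.EllipticCurves.KatoRankBoundProofs
import Literature.NumberTheory.EllipticCurves.CuspFormLFunction
import Literature.NumberTheory.NumberFields.CongruenceSubgroupTorsionFree
import HarnessLib

/-!
# Corner X8 (`p = 3`, good supersingular, `a_3 = ±3`), analytic rank `0`, ANY image, ANY conductor:
# Sprung's ♯/♭ Main Conjecture 7.21 at the pair ⟹ `BSD(E,3)` — the image-free rank-zero road of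
# Sprung 2024 §5.2 BY NAME (cell `bsd-print-x8`, seat p1 «Sprung 2024 BY NAME: acquire, type,
# discharge»; route-independent helper, `--supports` route `PrintX8` crux C3 `SharpFlatRankZeroLinkX8`,
# item stmt-BirchSwinnertonDyer-20313; it equally serves route `SignedLowerHalves` crux 6
# `SharpFlatResiduePPart`, item stmt-BirchSwinnertonDyer-19004 — its rank-`0` small-image clause)

PARTITION (D-0054(2)): corner X8 = K3 row A8 (`CornersAll` §1b), the cells `r_an = 0`; proves the
CLASS ROAD «♯/♭ main conjecture at `(E,3)` ⟹ `BSDp W 3`» WITHOUT the image hypothesis `Surj W 3`;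
closes NONE by itself (the main conjecture at `a_3 = ±3` is OPEN in print); 0 census cells move;
BSD is not proved by any of this. Beyond-print theorem: NO (it is the kernel form of the printed
deduction "integral main conjecture ⟹ (BSD_p)", Sprung, Adv. Math. 449 (2024) §5.2 pp. 39–41, Proof
of Thm. 5.3, which uses neither square-free `N` nor Conjecture 3.33 nor any image hypothesis).

## Why this file (by-name verdict of seat p1 on leaf X8, evidence at the page)

Sprung 2024 (version of record READ: NSF-PAR purl 10611567) proves the ♯/♭ main conjecture
(Thm. 1.1 = Thm. 5.1, p. 37) for square-free `N` ASSUMING his Conjecture 3.33 (p. 22: two-variable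
Beilinson–Flach classes `Δ_α, Δ_β ∈ H¹(K,T) ⊗ D^{1/2,0}_K` with reciprocity laws (*expq), (*expp),
(*logp) — no tree vocabulary; Burungale–Skinner–Tian–Wan arXiv:2409.01350 §1.5 "The hypothesis (h4)":
the `a_p ≠ 0` zeta elements are "not immediate from our constructions"), and DEDUCES (BSD_p) from the
main conjecture in §5.1 (rank `1`, Thm. 5.2 = [Kobayashi 2013, Proof of Cor. 1.3]) and §5.2 (rank `0`,
Thm. 5.3, Lemmas 5.5–5.9). So the by-name PRINT closer of corner X8 is CONDITIONAL, and the residual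
NAMED object is Main Conj. 7.21 at the pair = the tree's obligation node
`Theorems.SprungSharpFlatMainConjecture W 3 •` (littype-11). The existing kernel roads consume only
the Eisenstein HALF and therefore need Kato's integral divisibility, i.e. `Surj W 3`
(`K1Branch.bsdp_of_sprungSharpFlatLowerDivisibility`, `X8.bsdp_of_chromaticLowerDivisibility_of_surj_…`),
which is why crux 6 `SharpFlatResiduePPart` lists "rank 0 small image has no published upper half".
With the FULL main conjecture (an equality of ideals) Kato's theorem is not needed: this file proves
the image-free rank-`0` road, so that on X8 ∧ `r_an = 0` ∧ ¬Surj(3) the residual is ALSO exactly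
Main Conj. 7.21 at the pair (the rank-`1` clause and the route-decl forms `Theses.PrintX8.SharpFlatRankZeroLinkX8` /
`SharpFlatRankOneLinkX8` modulo named facts are the companion file `PrintX8SharpFlatLinks.lean`, via
the ♯/♭ reading of Burungale–Kobayashi–Ota Cor. A.5 typed by seat ty1, p532534). This file imports NO
route file (theses-cone hygiene): it is a per-pair library for both routes.

## What this file proves (all modulo PUBLISHED named facts, displayed)

* `X8.bsdp_of_sprungSharpFlatMainConjecture_of_analyticRank_eq_zero` — for an X8 pair of analytic
  rank `0` (any image, any conductor): `(∀ •, SprungSharpFlatMainConjecture W 3 •) → BSDp W 3`,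
  granted BY NAME `exists_isNewformOf` (BCDT), Sprung 2012 Thm. 2.2 (`thm22_…`, Honda system) and
  Thm. 7.14 (`thm714_…`, `X^•` finitely generated torsion), Sprung 2024 Lemmas 5.5–5.9 at all levels
  (`lem59AllN_…`, flag `Sprung24-§5.2-allN-via-RaySprung25`), the period unit at `3`
  (`realPeriodRat_eq_unit_mul_plusPeriod_three`, Mazur 1978 + Greenberg–Vatsal Rem. 3.4), GZK,
  modularity (`hasEntireLFunction_rat`). Proof = Sprung's §5.2: the real objects `(f, ϖ = u⁻¹, L♯,
  L♭)` (Sprung 2017 Thm. 1.12, PROVED), the cyclotomic setting and the REAL `X^•` (p470048), an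
  admissible colour (Prop. 6.14, PROVED), the main conjecture's generator `gen` with `ι gen = ϖ·ι L^•`
  and `ϖ ∈ ℤ_3^×` (`X8_norm_periodRatio_eq_one`) so `(gen) = (L^•)`, whence `gen ∣ L^•` replaces
  Kato's divisibility in b2b's exact form `bsdp_iff_span_eq_span_chromaticL_of_analyticRank_eq_zero`
  ((K•) = `lem59AllN`, (P•) a theorem, `3 ∤ c_•` = `ClassX8.not_dvd_chromaticConst'`).
* `X8.bsdp_of_sprungSharpFlatMainConjecture_col_of_analyticRank_eq_zero` — the same from the main
  conjecture for ONE colour `•` with `L^• ≠ 0` for the newform's Sprung pair (certificate shape).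
* `X8.missingPPartAt_of_sprungSharpFlatMainConjecture_of_analyticRank_eq_zero` — typed currency.
* `missingPPartAt_rankZero_of_mainConjecture` — CLASS form: «`∀` X8 pairs of analytic rank `0`,
  `∀ •`, `SprungSharpFlatMainConjecture W p •`» ⟹ «`∀` X8 pairs of analytic rank `0`,
  `MissingPPartAt W p`» — the body of route `PrintX8`'s C3 and the rank-`0` clause of route
  `SignedLowerHalves`' crux 6 (indeed without its `¬Surj` proviso), neither route file imported.

HONEST STATUS: CONDITIONAL on the displayed named facts (all PUBLISHED) and on the OPEN main
conjecture taken as hypothesis; closes nothing; X8 stays a corner. Not a new engine.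

References: [Sprung2024] Thm. 5.1 (p. 37), Thm. 5.3 (p. 38), §5.2 Lemmas 5.5–5.9 and Proof of
Thm. 5.3 (pp. 39–41), Conj. 3.33 (p. 22); [Sprung2012] Thm. 2.2, Prop. 6.14, Thm. 7.14, Prop. 7.19,
Main Conj. 7.21 (pp. 1487–1505); [Sprung2017] Thm. 1.12, Cor. 4.11; [RaySprung2025] p. 2343;
[Mazur1978] Cor. 4.1; [GreenbergVatsal2000] §3 Rem. 3.4; [Miller2011LMS] Def. 1.1;
[BurungaleSkinnerTianWan2024] §1.5.
-/

set_option autoImplicit false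
-- justification: the mandated namespace `Summit.BirchSwinnertonDyer.BirchSwinnertonDyer.Theorems`
-- (single-conjunct summit, Sub = Summit) repeats a segment by design (D-0017).
set_option linter.dupNamespace false

noncomputable section

namespace Summit.BirchSwinnertonDyer.BirchSwinnertonDyer.Theorems.X8MainConjectureRoad

open scoped Classical NumberField MatrixGroups ModularForm
open NumberField IsDedekindDomain WeierstrassCurve CongruenceSubgroup
  Literature.NumberTheory.EllipticCurves Literature.NumberTheory.EllipticCurves.ModularForms
  Literature.NumberTheory.EllipticCurves.Rank1Residual
  Literature.NumberTheory.EllipticCurves.Rank1Residual.Typed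
  Literature.NumberTheory.EllipticCurves.Sprung2017 Literature.NumberTheory.EllipticCurves.Sprung2012
  Literature.NumberTheory.EllipticCurves.Sprung2024
  Literature.NumberTheory.EllipticCurves.ZpExtension
  Summit.BirchSwinnertonDyer.Rank1Residual.Supersingular

/-! ### §1. Per pair, one admissible colour: Main Conj. 7.21 for `•` with `L^• ≠ 0` ⟹ `BSD(E,3)` -/

/-- **X8 ∧ `r_an = 0`, ANY image: the ♯/♭ main conjecture for ONE admissible colour gives
`BSD(E,3)`.** For an X8 pair (`p = 3`, good supersingular, `a_3 = ±3`) of analytic rank `0`, the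
cyclotomic setting `(κ, γ)`, the place `v ∋ 3` with local lift `g`, a Honda system `(cneg, c)`, the
newform `f` of `W` with `ϖ·Ω_E = Ω⁺_f`, a Sprung pair `(L♯, L♭)` and a colour `•` with `L^• ≠ 0`:
if for the REAL dual `X^•` (`sharpFlatSelmerDualData`, p470048) `char X^• = (gen)` with
`ι gen = ϖ·ι L^•` (Main Conj. 7.21 at the pair for `•`), then `BSDp W 3` — granted BY NAME Sprung 2012
Thm. 7.14 (`h714`), Sprung 2024 Lemmas 5.5–5.9 at all levels (`h59`), the period unit at `3` (`h3`),
GZK, modularity. NO `Surj W 3`, NO Kato divisibility: the equality `(gen) = (L^•)` (`ϖ ∈ ℤ_3^×`)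
supplies the divisibility `gen ∣ L^•` that b2b's exact form
`bsdp_iff_span_eq_span_chromaticL_of_analyticRank_eq_zero` consumes. This is Sprung 2024 §5.2 (Proof
of Thm. 5.3) in the kernel. PER PAIR; conditional; closes nothing.
[cite: Sprung2024, Thm. 5.3 (p. 38) and §5.2 Lemmas 5.5–5.9, Proof of Thm. 5.3 (pp. 39–41)]
[cite: Sprung2012, Thm. 7.14 (p. 1504) and Main Conj. 7.21 (p. 1505)] [cite: Sprung2017, Cor. 4.11]
[cite: Miller2011LMS, Def. 1.1] -/
theorem X8.bsdp_of_charIdeal_eq_of_analyticRank_eq_zero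
    (h714 : thm714_sharpFlatSelmerDual_finite_torsion)
    (h59 : lem59AllN_sharpFlatCharValue_rankZero)
    (h3 : realPeriodRat_eq_unit_mul_plusPeriod_three)
    (hGZK : rank_eq_analyticRank_of_analyticRank_le_one) (hmod : hasEntireLFunction_rat)
    (W : WeierstrassCurve ℚ) [W.IsElliptic] [W.IsGloballyMinimal] (p : ℕ) [Fact p.Prime]
    (hX : ClassX8 W p) (h0 : W.analyticRank = 0)
    {κ : ZpExtension ℚ p} {γ : Field.absoluteGaloisGroup ℚ} (hκ : κ.IsCyclotomic)
    (hγ : κ.IsTopGenerator γ) (hγ' : IsCyclotomicVariable p γ)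
    {v : HeightOneSpectrum (𝓞 ℚ)} (hv : (p : 𝓞 ℚ) ∈ v.asIdeal)
    {g : Field.absoluteGaloisGroup (v.adicCompletion ℚ)}
    (hg : κ.IsTopGenerator (resGalOfEmb (closureEmb (K := ℚ) (v.adicCompletion ℚ)) g))
    {cneg : localPoints W (v.adicCompletion ℚ)} {c : ℕ → localPoints W (v.adicCompletion ℚ)}
    (hc : IsHondaSystem κ (closureEmb (K := ℚ) (v.adicCompletion ℚ)) W (W.frobeniusTrace p) g cneg c)
    {N : ℕ} [NeZero N] {f : CuspForm (Gamma0 N) 2} (hf : IsNewformOf W f)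
    {ϖ : ℚ} (hϖ : (ϖ : ℝ) * W.realPeriodRat = plusPeriod f)
    {Lsharp Lflat : IwasawaAlgebra p} (hSP : IsSprungPair f p (W.frobeniusTrace p) Lsharp Lflat)
    (col : Chroma) (hcol : chromaticL col Lsharp Lflat ≠ 0)
    (D : SharpFlatSelmerDualData W κ γ (closureEmb (K := ℚ) (v.adicCompletion ℚ))
      (W.frobeniusTrace p) g c col)
    (gen : IwasawaAlgebra p) (hchar : D.charIdeal = Ideal.span {gen})
    (hι : iwasawaToPowerSeries p gen =
      PowerSeries.C (ϖ : ℚ_[p]) * iwasawaToPowerSeries p (chromaticL col Lsharp Lflat)) :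
    BSDp W p := by
  have hp3 : p = 3 := hX.1
  subst hp3
  have hp2 : (3 : ℕ) ≠ 2 := by decide
  have hgood : W.HasGoodReductionAtPrime 3 := hX.2.1.1
  have hdvd : ((3 : ℕ) : ℤ) ∣ W.frobeniusTrace 3 := hX.2.1.2
  have hirr : W.HasIrreducibleModPGaloisRep 3 := ClassX8.irr W 3 hX
  have hL : W.entireLFunction 1 ≠ 0 := (W.analyticRank_eq_zero_iff_holds (hmod W)).1 h0
  -- Sprung 2012 Thm. 7.14: `X^•` finitely generated and `Λ`-torsion
  obtain ⟨hfinD, htorD⟩ :=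
    h714 W 3 hp2 hgood hdvd f hf κ γ hκ hγ hγ' v hv g hg cneg c hc col Lsharp Lflat hSP hcol D
  haveI := hfinD
  -- (K•) by name (Sprung 2024 Lemmas 5.5–5.9, all levels)
  have hK : (⟨gen, 0, 0⟩ : SignedDatum W 3).EulerCharacteristic := fun hfin =>
    h59 W 3 hp2 hgood hdvd hL κ γ hκ hγ hγ' v hv g hg cneg c hc col D htorD gen hchar hfin
  -- `ϖ ∈ ℤ_3^×`, so the main conjecture's `ι gen = ϖ · ι L^•` gives `(gen) = (L^•)`
  have hϖ1 : ‖(ϖ : ℚ_[3])‖ = 1 := X8_norm_periodRatio_eq_one h3 W 3 hX hf hϖ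
  obtain ⟨hspan', hι'⟩ := span_C_units_mul_eq (PadicInt.mkUnits hϖ1) (chromaticL col Lsharp Lflat)
  have hgen_eq : gen = PowerSeries.C ((PadicInt.mkUnits hϖ1 : ℤ_[3]ˣ) : ℤ_[3]) *
      chromaticL col Lsharp Lflat := by
    apply iwasawaToPowerSeries_injective 3
    rw [hι, hι', PadicInt.mkUnits_eq]
  have hspan : Ideal.span ({gen} : Set (IwasawaAlgebra 3)) =
      Ideal.span {chromaticL col Lsharp Lflat} := by
    rw [hgen_eq, hspan']
  -- hence `gen ∣ L^•` (no Kato divisibility needed) and b2b's exact form concludes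
  have hU : gen ∣ chromaticL col Lsharp Lflat :=
    (Ideal.span_singleton_eq_span_singleton.mp hspan).dvd
  exact (bsdp_iff_span_eq_span_chromaticL_of_analyticRank_eq_zero W 3 hGZK hp2 hgood hirr hL hf
    (h3 W hgood hirr f hf) hSP col (ClassX8.not_dvd_chromaticConst' W 3 hX col) gen hK hU).mpr hspan

/-- **X8 ∧ `r_an = 0`, ANY image, certificate shape: Main Conj. 7.21 for ONE colour `•` — the tree's
`Theorems.SprungSharpFlatMainConjecture W 3 •` — together with `L^• ≠ 0` for the Sprung pair of SOME
newform of `W` gives `BSD(E,3)`**, granted BY NAME modularity (`hmodf` = `exists_isNewformOf`, used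
only through S4's edges), Sprung 2012 Thm. 2.2 (`h22`) and Thm. 7.14 (`h714`), Sprung 2024 Lemmas
5.5–5.9 (`h59`), the period unit at `3` (`h3`), GZK, modularity of `L(E,s)` (`hmod`). The admissible
pair `(f, L♯, L♭)` is the displayed one (`IsSprungPair.unique` makes it THE pair). PER PAIR.
[cite: Sprung2024, §5.2 (pp. 39–41)] [cite: Sprung2012, Thm. 2.2 (p. 1487), Thm. 7.14 and Main Conj. 7.21 (pp. 1504–1505)]
[cite: Miller2011LMS, Def. 1.1] -/
theorem X8.bsdp_of_sprungSharpFlatMainConjecture_col_of_analyticRank_eq_zero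
    (h22 : thm22_exists_isHondaSystem)
    (h714 : thm714_sharpFlatSelmerDual_finite_torsion)
    (h59 : lem59AllN_sharpFlatCharValue_rankZero)
    (h3 : realPeriodRat_eq_unit_mul_plusPeriod_three)
    (hGZK : rank_eq_analyticRank_of_analyticRank_le_one) (hmod : hasEntireLFunction_rat)
    (W : WeierstrassCurve ℚ) [W.IsElliptic] [W.IsGloballyMinimal] (p : ℕ) [Fact p.Prime]
    (hX : ClassX8 W p) (h0 : W.analyticRank = 0) (col : Chroma)
    {N : ℕ} [NeZero N] {f : CuspForm (Gamma0 N) 2} (hf : IsNewformOf W f)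
    {Lsharp Lflat : IwasawaAlgebra p} (hSP : IsSprungPair f p (W.frobeniusTrace p) Lsharp Lflat)
    (hcol : chromaticL col Lsharp Lflat ≠ 0)
    (hMC : SprungSharpFlatMainConjecture W p col) : BSDp W p := by
  have hp3 : p = 3 := hX.1
  subst hp3
  have hp2 : (3 : ℕ) ≠ 2 := by decide
  have hgood : W.HasGoodReductionAtPrime 3 := hX.2.1.1
  have hdvd : ((3 : ℕ) : ℤ) ∣ W.frobeniusTrace 3 := hX.2.1.2
  have hirr : W.HasIrreducibleModPGaloisRep 3 := ClassX8.irr W 3 hX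
  -- `ϖ := u⁻¹` from the period fact at `3`
  obtain ⟨u, hu1, hΩu⟩ := h3 W hgood hirr f hf
  have hu0 : u ≠ 0 := by
    rintro rfl
    rw [Rat.cast_zero, norm_zero] at hu1
    exact zero_ne_one hu1
  set ϖ : ℚ := u⁻¹ with hϖ_def
  have hϖ : (ϖ : ℝ) * W.realPeriodRat = plusPeriod f := by
    rw [hΩu, hϖ_def, Rat.cast_inv, ← mul_assoc, inv_mul_cancel₀ (Rat.cast_ne_zero.mpr hu0), one_mul]
  -- the cyclotomic setting, the place above `3`, the local lift, a Honda system (Thm. 2.2)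
  obtain ⟨κ, hκ, γ, hγ, hγ'⟩ := exists_isCyclotomic_isTopGenerator_isCyclotomicVariable_holds 3
  obtain ⟨v, hv⟩ :=
    Literature.NumberTheory.NumberFields.RingOfIntegers.exists_heightOneSpectrum_natCast_mem ℚ
      (p := 3) (by norm_num)
  obtain ⟨g, hg⟩ := hκ.exists_isTopGenerator_resGalOfEmb_adicCompletion v hv
  obtain ⟨cneg, c, hc⟩ := h22 W 3 hp2 hgood hdvd κ γ hκ hγ hγ' v hv g hg
  -- the REAL `X^•` and the main conjecture at the pair for `•`
  let D := sharpFlatSelmerDualData W κ (closureEmb (K := ℚ) (v.adicCompletion ℚ))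
    (W.frobeniusTrace 3) g c col hγ
  obtain ⟨-, gen, hchar, hι⟩ :=
    hMC κ γ hκ hγ hγ' v hv g hg cneg c hc N inferInstance f ϖ Lsharp Lflat hf hϖ hSP hcol D
  exact X8.bsdp_of_charIdeal_eq_of_analyticRank_eq_zero h714 h59 h3 hGZK hmod W 3 hX h0 hκ hγ hγ' hv
    hg hc hf hϖ hSP col hcol D gen hchar hι

/-! ### §2. Per pair, both colours: the obligation node `∀ •` ⟹ `BSD(E,3)` and the typed currency -/

/-- **X8 ∧ `r_an = 0`, ANY image, ANY conductor: Sprung's ♯/♭ Main Conjecture 7.21 at `(E, 3)` —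
`∀ •, Theorems.SprungSharpFlatMainConjecture W 3 •` (each colour self-guarded by `L^• ≠ 0`) — gives
Miller's `BSD(E,3)`**, granted BY NAME `exists_isNewformOf` (BCDT), Sprung 2012 Thm. 2.2 / 7.14, Sprung
2024 Lemmas 5.5–5.9 (all levels), the period unit at `3`, GZK and modularity. An admissible colour
exists (Sprung 2012 Prop. 6.14, tree theorem `IsSprungPair.exists_chromaticL_ne_zero`) for the Sprung
pair of Sprung 2017 Thm. 1.12 (tree theorem `thm112_exists_isSprungPair_holds`). The image-free
rank-zero X8 road — Sprung 2024 Thm. 5.3's deduction with Thm. 5.1's conclusion as the hypothesis.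
Conditional; closes nothing. [cite: Sprung2024, Thm. 5.3 (p. 38) and §5.2 (pp. 39–41)]
[cite: Sprung2012, Thm. 2.2, Prop. 6.14, Thm. 7.14 and Main Conj. 7.21] [cite: Sprung2017, Thm. 1.12]
[cite: Miller2011LMS, Def. 1.1] -/
theorem X8.bsdp_of_sprungSharpFlatMainConjecture_of_analyticRank_eq_zero
    (hmodf : exists_isNewformOf) (h22 : thm22_exists_isHondaSystem)
    (h714 : thm714_sharpFlatSelmerDual_finite_torsion)
    (h59 : lem59AllN_sharpFlatCharValue_rankZero)
    (h3 : realPeriodRat_eq_unit_mul_plusPeriod_three)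
    (hGZK : rank_eq_analyticRank_of_analyticRank_le_one) (hmod : hasEntireLFunction_rat)
    (W : WeierstrassCurve ℚ) [W.IsElliptic] [W.IsGloballyMinimal] (p : ℕ) [Fact p.Prime]
    (hX : ClassX8 W p) (h0 : W.analyticRank = 0)
    (hMC : ∀ col : Chroma, SprungSharpFlatMainConjecture W p col) : BSDp W p := by
  have hp3 : p = 3 := hX.1
  subst hp3
  have hgood : W.HasGoodReductionAtPrime 3 := hX.2.1.1
  have hdvd : ((3 : ℕ) : ℤ) ∣ W.frobeniusTrace 3 := hX.2.1.2
  haveI : NeZero (W.conductorNorm ℤ) := ⟨(W.conductorNorm_pos_holds).ne'⟩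
  obtain ⟨f, hf⟩ := hmodf W
  obtain ⟨Lsharp, Lflat, hSP⟩ :=
    thm112_exists_isSprungPair_holds (W := W) (f := f) (p := 3) (by decide) hf hgood hdvd
  obtain ⟨col, hcol⟩ := hSP.exists_chromaticL_ne_zero hf hgood
  exact X8.bsdp_of_sprungSharpFlatMainConjecture_col_of_analyticRank_eq_zero h22 h714 h59 h3 hGZK hmod
    W 3 hX h0 col hf hSP hcol (hMC col)

/-- **Typed currency**: X8 ∧ `r_an = 0`, any image: `∀ •, SprungSharpFlatMainConjecture W 3 •` ⟹
`MissingPPartAt W 3` (`ord_3 #Ш_an = ord_3 #Ш`), same named facts. [cite: Sprung2024, Thm. 5.3 (p. 38)]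
[cite: Miller2011LMS, Def. 1.1] -/
theorem X8.missingPPartAt_of_sprungSharpFlatMainConjecture_of_analyticRank_eq_zero
    (hmodf : exists_isNewformOf) (h22 : thm22_exists_isHondaSystem)
    (h714 : thm714_sharpFlatSelmerDual_finite_torsion)
    (h59 : lem59AllN_sharpFlatCharValue_rankZero)
    (h3 : realPeriodRat_eq_unit_mul_plusPeriod_three)
    (hGZK : rank_eq_analyticRank_of_analyticRank_le_one) (hmod : hasEntireLFunction_rat)
    (W : WeierstrassCurve ℚ) [W.IsElliptic] [W.IsGloballyMinimal] (p : ℕ) [Fact p.Prime]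
    (hX : ClassX8 W p) (h0 : W.analyticRank = 0)
    (hMC : ∀ col : Chroma, SprungSharpFlatMainConjecture W p col) : MissingPPartAt W p := by
  haveI : Finite W.sha := (hGZK W (by omega)).2
  exact missingPPartAt_of_bsdp W p
    (X8.bsdp_of_sprungSharpFlatMainConjecture_of_analyticRank_eq_zero hmodf h22 h714 h59 h3 hGZK hmod
      W p hX h0 hMC)

/-! ### §3. Class form: the rank-`0` X8 cells, Main Conj. 7.21 ⟹ `MissingPPartAt` -/

/-- **The rank-zero X8 cells BY NAME (class form, no route file imported).** Modulo the displayed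
PUBLISHED facts, the ♯/♭ main conjecture on the X8 pairs of analytic rank `0` (both colours) gives the
typed output `MissingPPartAt` at EVERY such pair — in particular on the 60 small-image cells `¬Surj(3)`
(image `3Nn`) that route `SignedLowerHalves` declared residual (crux 6, rank-`0` clause) and that route
`PrintX8`'s C3 `SharpFlatRankZeroLinkX8` covers "ALL levels and BOTH 3-adic images". READING: on
X8 ∧ `r_an = 0` the residual is exactly Main Conj. 7.21 at the pair, with or without surjective
`ρ̄_{E,3}`. Conditional; closes nothing. [cite: Sprung2024, Thm. 5.3 (p. 38) and §5.2 (pp. 39–41)]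
[cite: Sprung2012, Main Conj. 7.21 (p. 1505)] -/
theorem missingPPartAt_rankZero_of_mainConjecture
    (hmodf : exists_isNewformOf) (h22 : thm22_exists_isHondaSystem)
    (h714 : thm714_sharpFlatSelmerDual_finite_torsion)
    (h59 : lem59AllN_sharpFlatCharValue_rankZero)
    (h3 : realPeriodRat_eq_unit_mul_plusPeriod_three)
    (hGZK : rank_eq_analyticRank_of_analyticRank_le_one) (hmod : hasEntireLFunction_rat)
    (hMC : ∀ (W : WeierstrassCurve ℚ) [W.IsElliptic] [W.IsGloballyMinimal] (p : ℕ) [Fact p.Prime],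
      ClassX8 W p → W.analyticRank = 0 → ∀ col : Chroma, SprungSharpFlatMainConjecture W p col) :
    ∀ (W : WeierstrassCurve ℚ) [W.IsElliptic] [W.IsGloballyMinimal] (p : ℕ) [Fact p.Prime],
      ClassX8 W p → W.analyticRank = 0 → MissingPPartAt W p :=
  fun W _ _ p _ hX h0 =>
    X8.missingPPartAt_of_sprungSharpFlatMainConjecture_of_analyticRank_eq_zero hmodf h22 h714 h59 h3
      hGZK hmod W p hX h0 (hMC W p hX h0)

end Summit.BirchSwinnertonDyer.BirchSwinnertonDyer.Theorems.X8MainConjectureRoad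

end
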